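import Summits.BirchSwinnertonDyer.BirchSwinnertonDyer.Theses.PrintX6
import Summits.BirchSwinnertonDyer.BirchSwinnertonDyer.Theorems.PrintX6KobayashiUpperHalf
import HarnessLib

/-!
# Route `PrintX6`, item `UpperHalfX6` (stmt-BirchSwinnertonDyer-20301): the rank-zero UPPER half
# `ord_p #Ш ≤ ord_p #Ш_an` on the leaf `ClassX6 ∧ r_an = 0`, from the route's published inputs — PROVED

HONEST FRAMING (cell `bsd-print-x6`, run/shared/lean/pub/bsd-print-x6/; PRINT tier D-0131 (2);
prover p2, strategy sentence «Kato divisibility + Kobayashi ± control ⇒ #Ш[p^∞] ≤ the p-adic bound;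
unit cells by the trivial lower bound»). THEOREMS ONLY; nothing about any particular curve is
asserted; BSD is not proved by any of this.

The item reads `PublishedInputsX6 → ∀ W p, p ≠ 2 → ClassX6 W p → W.analyticRank = 0 →
MissingUpperBoundAt W p` (`Theses/PrintX6.lean`). The chain is the tree theorem
`Summit.BirchSwinnertonDyer.BirchSwinnertonDyer.Theorems.X6.missingUpperBoundAt_rankZero_of_thm41`
(`Theorems/PrintX6KobayashiUpperHalf.lean`, p532875): Kobayashi 2003 Thm. 4.1 INTEGRAL clause
(`ξ ∣ L_p^ε`, `p`-adic surjectivity automatic on X6 by `ClassX6.imageContainsSL2` — Serre Props. 12,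
21 i), IV-23; Wuthrich 2014 Lemma 20 at `p = 3`, PROVED in the tree, so the `lemma20_…` conjunct of
the inputs is not even used) + Thm. 1.2 + B. D. Kim 2013 Cor. 3.15 (exact ± control at `n = 0`) +
the period-unit facts + Pollack (3.6) PROVED + modularity + GZK, read in valuations of constant
terms. This file only unpacks the conjunction `PublishedInputsX6` (Kobayashi Thm. 1.2, Thm. 4.1, Kim
Cor. 3.15, period unit at `p ≥ 5` and at `3`, Wuthrich Lemma 20, modularity ×2, GZK — in that order)
and applies the chain; and records the UNIT-CELL corollary in the route's own currency.
[cite: Kobayashi2003, Thm. 4.1 (p. 8) and Thm. 1.2 (p. 2)] [cite: BDKim2013, Cor. 3.15 (p. 199)]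
[cite: GreenbergVatsal2000, §3, Remark 3.4] [cite: Miller2011LMS, Def. 1.1]
-/

set_option autoImplicit false
-- the landed namespace `Summit.BirchSwinnertonDyer.BirchSwinnertonDyer.Theorems` (summit = problem) trips the linter
set_option linter.dupNamespace false

noncomputable section

open scoped Classical

open WeierstrassCurve Literature.NumberTheory.EllipticCurves
  Literature.NumberTheory.EllipticCurves.Rank1Residual
  Literature.NumberTheory.EllipticCurves.Rank1Residual.Typed
  Summit.BirchSwinnertonDyer.BirchSwinnertonDyer.Theses.PrintX6

namespace Summit.BirchSwinnertonDyer.BirchSwinnertonDyer.Theorems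

/-- **Route `PrintX6`, item `UpperHalfX6` (stmt-BirchSwinnertonDyer-20301), PROVED**: granted the
route's nine refereed inputs `PublishedInputsX6`, at every pair of the leaf (`p ≠ 2`, `ClassX6 W p`,
`ord_{s=1} L(E,s) = 0`) the upper half `ord_p #Ш(E/ℚ) ≤ ord_p #Ш(E)_an` (`MissingUpperBoundAt W p`)
holds — by `X6.missingUpperBoundAt_rankZero_of_thm41` (Kobayashi Thm. 4.1 / 1.2 + Kim Cor. 3.15 +
period units + modularity + GZK; the Wuthrich-Lemma-20 conjunct is unused because 3-adic surjectivity
on X6 is a tree theorem). [cite: Kobayashi2003, Thm. 4.1 (p. 8) and Thm. 1.2 (p. 2)]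
[cite: BDKim2013, Cor. 3.15 (p. 199)] [cite: GreenbergVatsal2000, §3, Remark 3.4] [cite: Miller2011LMS, Def. 1.1] -/
theorem upperHalfX6_proof : Summit.BirchSwinnertonDyer.BirchSwinnertonDyer.Theses.PrintX6.UpperHalfX6 := by
  intro hPub W _ _ p _ hp hX h0
  obtain ⟨h12, h41, hKim, h5, h3, -, hmod, hmod', hGZK⟩ := hPub
  exact X6.missingUpperBoundAt_rankZero_of_thm41 W p h41 h12 hKim h5 h3 hmod hmod' hGZK hp hX h0

/-- **The UNIT cells of the leaf are `BSD(E,p)` on the route's inputs alone** (no Eisenstein-half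
crux): `PublishedInputsX6`, a pair of the leaf, and `#Ш_an = q` with `ord_p q ≤ 0` ⇒ Miller's
`BSDp W p` — upper half by `upperHalfX6_proof`, lower half trivial (`X6.bsdp_rankZero_of_shaAn_le_of_thm41`).
[cite: Kobayashi2003, Thm. 4.1 (p. 8)] [cite: BDKim2013, Cor. 3.15 (p. 199)] [cite: Miller2011LMS, §1 and Def. 1.1] -/
theorem X6.bsdp_rankZero_of_shaAn_le_of_publishedInputsX6 (hPub : PublishedInputsX6)
    (W : WeierstrassCurve ℚ) [W.IsElliptic] [W.IsGloballyMinimal] (p : ℕ) [Fact p.Prime]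
    (hp : p ≠ 2) (hX : ClassX6 W p) (h0 : W.analyticRank = 0)
    (hsha : ∃ q : ℚ, shaAn W = (q : ℂ) ∧ padicValRat p q ≤ 0) : BSDp W p := by
  obtain ⟨h12, h41, hKim, h5, h3, -, hmod, hmod', hGZK⟩ := hPub
  exact X6.bsdp_rankZero_of_shaAn_le_of_thm41 W p h41 h12 hKim h5 h3 hmod hmod' hGZK hp hX h0 hsha

/-- **Sharp form on the unit cells, route currency**: `PublishedInputsX6` + a unit-value pair of the
leaf ⇒ `p ∤ #Ш(E/ℚ)` and `ord_p #Ш_an = 0` exactly. [cite: Kobayashi2003, Thm. 4.1 (p. 8)]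
[cite: BDKim2013, Cor. 3.15 (p. 199)] [cite: Miller2011LMS, Def. 1.1] -/
theorem X6.padicValNat_shaOrder_eq_zero_of_shaAn_le_of_publishedInputsX6 (hPub : PublishedInputsX6)
    (W : WeierstrassCurve ℚ) [W.IsElliptic] [W.IsGloballyMinimal] (p : ℕ) [Fact p.Prime]
    (hp : p ≠ 2) (hX : ClassX6 W p) (h0 : W.analyticRank = 0)
    (hsha : ∃ q : ℚ, shaAn W = (q : ℂ) ∧ padicValRat p q ≤ 0) :
    padicValNat p W.shaOrder = 0 ∧ ∃ q : ℚ, shaAn W = (q : ℂ) ∧ padicValRat p q = 0 := by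
  obtain ⟨h12, h41, hKim, h5, h3, -, hmod, hmod', hGZK⟩ := hPub
  exact X6.padicValNat_shaOrder_eq_zero_of_shaAn_le_of_thm41 W p h41 h12 hKim h5 h3 hmod hmod' hGZK
    hp hX h0 hsha

end Summit.BirchSwinnertonDyer.BirchSwinnertonDyer.Theorems

end
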